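import Mathlib
import HarnessLib
import Summits.FinalStateConjecture.Statement
import Literature.Geometry.Lorentzian.SpacetimeLocalConvergenceChartOrientation
import Literature.Geometry.Lorentzian.BackgroundChartCalculus
import Literature.Geometry.Lorentzian.KerrSchildDivergence
import Literature.Geometry.Lorentzian.KerrSchildCoord
import Literature.Geometry.Lorentzian.TimeCones

/-!
# Sketch (crux-ideate, ideator 1, round 1) — crux `FutureOrientedOfSeamed` (stmt-FinalStateConjecture-17576)

First lemmas of the two idea cards, stated over existing declarations (elaboration only; `sorry`
proofs).  Card A = `frozen-null-line-transport`, Card B = `seam-anchor-orthochronous`.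
A1, A1', A2, A3, A4 are PROVED sorry-free in the companion file `LeverKit.lean` (rc 0); they are kept
here as statements so that this file documents the whole signature set of both cards.
-/

open scoped Manifold ContDiff Topology ENNReal
open Filter Set

noncomputable section

namespace Summit.FinalStateConjecture.FinalStateConjecture.Cruxes.FutureOrientedOfSeamed.Ideator1

open Literature.Geometry.Lorentzian

set_option linter.unusedVariables false
set_option linter.dupNamespace false

/-! ## Card A — frozen-vector transport along in-slab principal-null-plus-time lines -/

/-- **A1 (Kerr–Schild algebra, the lever's margin).** Along the straight in-slab line
`y(s) = x + s (ℓ♯ₓ + e₀)` (`t*` constant, `r(y(s)) = r(x) + s`, `ℓ_{y(s)} = ℓ_x`, `H` non-increasing),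
the time vector FROZEN at the inner endpoint stays uniformly timelike:
`g_{M,a}(y(s))(V(x), V(x)) = −1 − 4H(x) + 2H(y(s)) ≤ −1`. -/
theorem kerr_bilin_frozen_timeVector_le {M a : ℝ} (hM : 0 ≤ M) {x : E4}
    (hr : 0 < Kerr.radius a x) (ha : |a| ≤ Kerr.radius a x) {s : ℝ} (hs : 0 ≤ s) :
    Kerr.bilin M a (x + s • (Kerr.nullVector a x + E4.basisVector 0))
      (Kerr.timeVector M a x) (Kerr.timeVector M a x) ≤ -1 := by
  sorry

/-- **A1' (anchor pairing).** On the same line the frozen vector pairs negatively with `e₀`: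
`g_{M,a}(y(s))(e₀, V(x)) = −1 − 2H(x) + 2H(y(s)) ≤ −1 + 2M/(r(x) + s)` (≤ −0.98 at an anchor radius
`r(x) + s ≥ 100M`: same timecone as the SEAMED (5) anchor `Λe₀`). PROVED in `LeverKit.lean`. -/
theorem kerr_bilin_basisVector_frozen_timeVector_le {M a : ℝ} (hM : 0 ≤ M) {x : E4}
    (hr : 0 < Kerr.radius a x) {s : ℝ} (hs : 0 ≤ s) :
    Kerr.bilin M a (x + s • (Kerr.nullVector a x + E4.basisVector 0))
      (E4.basisVector 0) (Kerr.timeVector M a x) ≤ -1 + 2 * M / (Kerr.radius a x + s) := by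
  sorry

/-- **A1'' (inward version, outer zone).** Frozen at the OUTER endpoint `x` and moving inward,
`y(s) = x − s (ℓ♯ₓ + e₀)`, `0 ≤ s`, down to a radius `r(x) − s ≥ 2M + δ`: margin `1 − 2M/(r(x) − s)`. -/
theorem kerr_bilin_frozen_timeVector_le_inward {M a : ℝ} (hM : 0 ≤ M) {x : E4}
    (hr : 0 < Kerr.radius a x) (ha : |a| ≤ Kerr.radius a x) {s : ℝ} (hs : 0 ≤ s)
    (hrs : 0 < Kerr.radius a x - s) (h4 : 4 * M ≤ Kerr.radius a x - s) :
    Kerr.bilin M a (x - s • (Kerr.nullVector a x + E4.basisVector 0))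
      (Kerr.timeVector M a x) (Kerr.timeVector M a x) ≤ -(1 / 2) := by
  sorry

/-- **A2 (segment transport; corollary of `Spacetime.isFutureDirected_mfderiv_of_isPreconnected`
with the CONSTANT vector `W` on the convex, hence preconnected, segment, via the
`Ψ ∘ (chartAt E4 ·).symm` glue of `BackgroundChartCalculus`).** -/
theorem isFutureDirected_mfderiv_of_segment {𝓢 : Spacetime.{0} 4} (B : ModelBackground)
    (Ψ : B.domain → 𝓢.carrier) (hΨ : ContMDiff 𝓘(ℝ, E4) (𝓡 4) ∞ Ψ) (x y : B.domain) (W : E4)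
    (hseg : segment ℝ (x : E4) (y : E4) ⊆ (B.domain : Set E4))
    (hc : ∀ z : B.domain, (z : E4) ∈ segment ℝ (x : E4) (y : E4) →
      𝓢.metric.IsCausal (mfderiv 𝓘(ℝ, E4) (𝓡 4) Ψ z W))
    (hy : 𝓢.timeOrientation.IsFutureDirected (mfderiv 𝓘(ℝ, E4) (𝓡 4) Ψ y W)) :
    𝓢.timeOrientation.IsFutureDirected (mfderiv 𝓘(ℝ, E4) (𝓡 4) Ψ x W) := by
  sorry

/-- **A3 (pointwise timelikeness from the `C⁰` deviation).**
`g(dΨ W, dΨ W) = g₀(z)(W, W) + (Ψ^*g − g₀)(z)(W, W) ≤ −m + ε‖W‖² < 0`. -/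
theorem isTimelike_mfderiv_of_norm_deviation_le {𝓢 : Spacetime.{0} 4} (B : ModelBackground)
    (Ψ : B.domain → 𝓢.carrier) (z : B.domain) (W : E4) {m ε : ℝ}
    (hB : B.bilin (z : E4) W W ≤ -m) (hdev : ‖𝓢.deviation B Ψ z‖ ≤ ε) (h : ε * ‖W‖ ^ 2 < m) :
    𝓢.metric.IsTimelike (mfderiv 𝓘(ℝ, E4) (𝓡 4) Ψ z W) := by
  sorry

/-- **A4 (pointwise same-cone conversion, `TimeOrientation.isFutureDirected_of_val_lt_zero`).** -/
theorem isFutureDirected_mfderiv_of_pairing_neg {𝓢 : Spacetime.{0} 4} (B : ModelBackground)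
    (Ψ : B.domain → 𝓢.carrier) (z : B.domain) (A W : E4)
    (hA : 𝓢.timeOrientation.IsFutureDirected (mfderiv 𝓘(ℝ, E4) (𝓡 4) Ψ z A))
    (hAt : 𝓢.metric.IsTimelike (mfderiv 𝓘(ℝ, E4) (𝓡 4) Ψ z A))
    (hW : 𝓢.metric.IsCausal (mfderiv 𝓘(ℝ, E4) (𝓡 4) Ψ z W))
    (hneg : B.bilin (z : E4) A W + 𝓢.deviation B Ψ z A W < 0) :
    𝓢.timeOrientation.IsFutureDirected (mfderiv 𝓘(ℝ, E4) (𝓡 4) Ψ z W) := by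
  sorry

/-- **A5 (the transfer target `ClauseII`: clause (ii) of `IsFutureOriented` for ONE decomposition from
the anchor alone).**  Hypotheses = what the line actually uses: `100 Mᵢ ≤ R₀`, `R₀ + 4 ≤ Rᵢ`, and the
SEAMED (5) anchor on hole-late certified tubes; everything else comes from the structure fields
(`tendsto_truncDeviationCk`, `mass_pos`, `abs_spin_le_mass`, `isLateChart`). -/
theorem clauseII_of_anchor {𝓢 : Spacetime.{0} 4} {O : Set 𝓢.carrier}
    (d : FinalStateDecomposition 𝓢 O 2) (R : Fin d.N → ℝ → ℝ) (R₀ : ℝ)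
    (h100 : ∀ i, 100 * d.mass i ≤ R₀) (hR : ∀ i s, R₀ + 4 ≤ R i s)
    (hanchor : ∀ i (x : (d.background i).domain), d.τ₀ ≤ (d.background i).time x.1 →
      R₀ ≤ (d.background i).radius x.1 → (d.background i).radius x.1 ≤ R i ((d.background i).time x.1) →
      𝓢.timeOrientation.IsFutureDirected (mfderiv 𝓘(ℝ, E4) (𝓡 4) (d.chart i) x
        (((d.motion i).1 : E4 ≃L[ℝ] E4) (E4.basisVector 0)))) :
    ∀ i (ρ : ℝ), ∀ᶠ τ in atTop, ∀ x ∈ (d.background i).truncTimeSlab ρ τ,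
      𝓢.timeOrientation.IsFutureDirected
        (mfderiv 𝓘(ℝ, E4) (𝓡 4) (d.chart i) x
          (((d.motion i).1 : E4 ≃L[ℝ] E4)
            (Kerr.timeVector (d.mass i) (d.spin i)
              (poincareInv (d.motion i).1 (d.motion i).2 (x : E4))))) := by
  sorry

/-! ## Card B — the seam anchor (orientation imported from the flat chart, orthochronous conversion) -/

/-- **B1 (orthochronous conversion, Kerr–Schild algebra).** For an orthochronous Lorentz `Λ`,
`g_{M,a}(x)(Λ⁻¹ e₀, V(x)) = −(Λ⁻¹e₀)⁰ = −(Λe₀)⁰ ≤ −1`: the rest-frame time axis seen from the hole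
chart pairs negatively with `V`, so `dΨᵢ(e₀)` future ⇒ `dΨᵢ(ΛV)` future (with `A4`). -/
theorem kerr_bilin_symm_basisVector_timeVector_le (Λ : lorentzGroup)
    (hΛ : 0 < (Λ : E4 ≃L[ℝ] E4) (E4.basisVector 0) 0) {M a : ℝ} {x : E4}
    (hx : 0 < Kerr.radius a x) :
    Kerr.bilin M a x ((Λ : E4 ≃L[ℝ] E4).symm (E4.basisVector 0)) (Kerr.timeVector M a x) ≤ -1 := by
  sorry

/-- **B2 (seam anchor).** Where the hole chart and the flat chart agree on an OPEN coordinate set `U`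
(SEAMED (6) one-atlas identity on the open set supplied by SEAMED (7), (9), (10), (13) and the structure
field `setOf_lt_excision_subset_flatDomain`), the flat chart's orientation HonestCore (d) is the hole
chart's: `dΨᵢ(e₀) = dΦ(e₀)` is future-directed on `U`. -/
theorem isFutureDirected_chart_of_seam {𝓢 : Spacetime.{0} 4} {O : Set 𝓢.carrier} {k : ℕ}
    (d : FinalStateDecomposition 𝓢 O k) (i : Fin d.N) (U : Set E4) (hU : IsOpen U)
    (hUi : U ⊆ ((d.background i).domain : Set E4)) (hUf : U ⊆ (d.flatDomain : Set E4))
    (hseam : ∀ y (hy : y ∈ U), d.chart i ⟨y, hUi hy⟩ = d.flatChart ⟨y, hUf hy⟩)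
    (horient : ∀ y (hy : y ∈ U), 𝓢.timeOrientation.IsFutureDirected
      (mfderiv 𝓘(ℝ, E4) (𝓡 4) d.flatChart ⟨y, hUf hy⟩ (E4.basisVector 0)))
    (y : E4) (hy : y ∈ U) :
    𝓢.timeOrientation.IsFutureDirected
      (mfderiv 𝓘(ℝ, E4) (𝓡 4) (d.chart i) ⟨y, hUi hy⟩ (E4.basisVector 0)) := by
  sorry

end Summit.FinalStateConjecture.FinalStateConjecture.Cruxes.FutureOrientedOfSeamed.Ideator1

end
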